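import Literature.AlgebraicTopology.KTheory.BottClutching
import Literature.AlgebraicTopology.KTheory.CoverTrivial
import Literature.AlgebraicTopology.KTheory.SphereCaps
import Literature.LinearAlgebra.Matrix.GLPathConnected
import Mathlib.Topology.Homotopy.Contractible
import HarnessLib

/-!
# Clutching functions over spheres with `K̃⁰ = 0` are stably null-homotopic

The injectivity half of the clutching classification of bundles over a sphere
(Husemöller, *Fibre Bundles*, Ch. 8 §7 / Ch. 9 Thm. 7.3; Hatcher, *Vector Bundles and K-Theory*,
Prop. 1.11: `[S^{k}, GL_N(ℂ)] → Vect_N(S^{k+1})` is a bijection, "if `E_f ≅ E_g` then `f ≃ g`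
since the isomorphism restricted to the two discs gives maps `D^{k+1} → GL_N(ℂ)`, which are
homotopic to constants"), in the idempotent model of the tree's `K⁰(X) = K₀(C(X, ℂ))`
(`Literature/AlgebraicTopology/KTheory/`): if the reduced group `K̃⁰(𝕊ᵏ⁺¹)` vanishes, then every
continuous invertible-matrix-valued map on the equator `𝕊ᵏ = D₊ ∩ D₋` of `𝕊ᵏ⁺¹` (caps
`cap (±e)` of `SphereCaps.lean`) becomes **homotopic to the constant `1` through invertible
matrices after a block sum with an identity matrix** (`exists_homotopy_fromBlocks_one_of_reduced_eq_bot`).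
This is the bridge from complex Bott periodicity (`K̃⁰(𝕊⁷) = 0`) to `π₆(GL(ℂ)) = 0` stably, used
for `Literature.Topology.FourManifolds.Bott1959_sphereMapsToStableFramesExtend_six`.
Everything PROVED; no named facts:

* §1 **transition functions of two trivialising gluing witnesses of one idempotent differ by
  invertible changes of frame**: for witnesses `w, w'` of the same `Q` with trivial local models
  `1`, `w'.g = c₂|_A · w.g · d₁|_A` with `c₂ = y₂' x₂` invertible over `X₂` and `d₁ = y₁ x₁'`
  invertible over `X₁` (`GluingWitness.g_eq_conj`; Husemöller et al., Ch. 3 §7 (7.4)).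
* §2 the sphere `𝕊ᵏ⁺¹ ⊂ ℝᵏ⁺²`, its caps in the last axis and their equator.
* §3 the theorem: glue `1_N ∪_G 1_N = Q` (`exists_gluingWitness`), `rank Q = N` everywhere, so
  `[Q] - [1_N] ∈ K̃⁰ = 0`, `[Q] = [1_N]`, `1_a ⊕ Q ∼ 1_{a+N}` for some `a`
  (`KZero.of_eq_of_iff_exists_unit`); transport the witness `1_a ⊕ w` (transition `1 ⊕ G`) to
  the constant idempotent `1_{a+N}` (`ofAlgEquivalent`) and compare with its tautological witness
  (transition `1`) by §1: `1 ⊕ G = c₂|_A d₁|_A`; the caps are contractible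
  (`contractibleSpace_cap`), so `c₂, d₁` deform to constants through invertible (rectangular,
  two-sided invertible) matrices, and `GL` is path connected (`isPathConnected_isUnit_det`).

## References

* D. Husemöller, *Fibre Bundles*, 3rd ed. (1994) [HusemollerFibreBundles1994]: Ch. 9 Thm. 7.3
  (`Vect_n(S X) ≅ [X, GL_n]`), Ch. 11 Prop. 2.3.
* D. Husemöller, M. Joachim, B. Jurčo, M. Schottenloher, *Basic Bundle Theory and K-Cohomology
  Invariants* (2008) [HusemollerEtAl2008]: Ch. 3 §7 (7.2), (7.4).
* A. Hatcher, *Algebraic Topology*, CUP (2002), §4.2 Example 4.55; and *Vector Bundles and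
  K-Theory*, Prop. 1.11 (clutching over spheres). [HatcherAT2002]
-/

noncomputable section

namespace Literature.AlgebraicTopology.KTheory

open Literature.RingTheory.KTheory Literature.LinearAlgebra.Matrix Matrix Set Metric unitInterval

universe u

/-! ### 1. Two trivialising witnesses of one idempotent: transition functions are conjugate -/

section Compare

variable {Y : Type u} [TopologicalSpace Y] {X₁ X₂ : Set Y}
variable {m n n' : Type*} [Fintype m] [Fintype n] [Fintype n'] [DecidableEq n] [DecidableEq n']
variable {Q : Matrix m m C(Y, ℂ)}

namespace GluingWitness

variable (w : GluingWitness Q (1 : Matrix n n C(X₁, ℂ)) (1 : Matrix n n C(X₂, ℂ)))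
  (w' : GluingWitness Q (1 : Matrix n' n' C(X₁, ℂ)) (1 : Matrix n' n' C(X₂, ℂ)))

/-- The change of frame `c₂ = y₂' x₂` over `X₂` between two trivialising witnesses. [folklore] -/
def frame₂ : Matrix n' n C(X₂, ℂ) := w'.y₂ * w.x₂

/-- The change of frame `d₁ = y₁ x₁'` over `X₁` between two trivialising witnesses. [folklore] -/
def frame₁ : Matrix n n' C(X₁, ℂ) := w.y₁ * w'.x₁

/-- `c₂ = y₂' x₂` has the two-sided inverse `y₂ x₂'`. [folklore] -/
theorem frame₂_mul_frame₂ : frame₂ w w' * frame₂ w' w = 1 := by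
  rw [frame₂, frame₂, Matrix.mul_assoc, ← Matrix.mul_assoc w.x₂, w.hxy₂, ← Matrix.mul_assoc, w'.y₂_mul_restrict₂, w'.hyx₂]

/-- `d₁ = y₁ x₁'` has the two-sided inverse `y₁' x₁`. [folklore] -/
theorem frame₁_mul_frame₁ : frame₁ w w' * frame₁ w' w = 1 := by
  rw [frame₁, frame₁, Matrix.mul_assoc, ← Matrix.mul_assoc w'.x₁, w'.hxy₁, ← Matrix.mul_assoc, w.y₁_mul_restrict₁, w.hyx₁]

/-- **Transition functions of two trivialising witnesses of the same idempotent are conjugate by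
the changes of frame**: `g' = c₂|_A · g · d₁|_A` (a bundle determines its clutching function up to
automorphisms of the two trivial pieces; Husemöller et al., Ch. 3 §7 (7.4)).
[cite: HusemollerEtAl2008, Ch. 3 §7 (7.4)] -/
theorem g_eq_conj : w'.g = (frame₂ w w').map (ovl₂ X₁ X₂) * w.g * (frame₁ w w').map (ovl₁ X₁ X₂) := by
  rw [frame₂, frame₁, GluingWitness.g, GluingWitness.g, Matrix.map_mul, Matrix.map_mul]
  -- `x₂|A y₂|A = Q|A = (Q|X₁)|A`
  have hQ : w.x₂.map (ovl₂ X₁ X₂) * w.y₂.map (ovl₂ X₁ X₂) = (Q.map (resHom X₁)).map (ovl₁ X₁ X₂) := by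
    rw [← Matrix.map_mul, w.hxy₂, map_resHom_ovl]
  calc w'.y₂.map (ovl₂ X₁ X₂) * w'.x₁.map (ovl₁ X₁ X₂)
      = w'.y₂.map (ovl₂ X₁ X₂) * (Q.map (resHom X₁) * w'.x₁).map (ovl₁ X₁ X₂) := by rw [w'.restrict₁_mul_x₁]
    _ = w'.y₂.map (ovl₂ X₁ X₂) * ((Q.map (resHom X₁) * w.x₁ * w.y₁ * w'.x₁).map (ovl₁ X₁ X₂)) := by
        rw [w.restrict₁_mul_x₁, w.hxy₁]
    _ = w'.y₂.map (ovl₂ X₁ X₂) * ((Q.map (resHom X₁)).map (ovl₁ X₁ X₂) * w.x₁.map (ovl₁ X₁ X₂) *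
          (w.y₁.map (ovl₁ X₁ X₂) * w'.x₁.map (ovl₁ X₁ X₂))) := by
        simp only [Matrix.map_mul, Matrix.mul_assoc]
    _ = _ := by rw [← hQ]; simp only [Matrix.mul_assoc]

end GluingWitness

end Compare

/-! ### 2. The sphere `𝕊ᵏ⁺¹ ⊂ ℝᵏ⁺²`, its caps along the last axis and the equator -/

section Sphere

variable {k : ℕ}

/-- The last coordinate axis `e = e_{k+1} ∈ ℝᵏ⁺²`. [folklore] -/
def lastAxis (k : ℕ) : EuclideanSpace ℝ (Fin (k + 2)) := EuclideanSpace.single (Fin.last (k + 1)) 1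

/-- `e ≠ 0`. [folklore] -/
theorem lastAxis_ne_zero : lastAxis k ≠ 0 := by
  intro h
  have := congrArg (fun v : EuclideanSpace ℝ (Fin (k + 2)) => v (Fin.last (k + 1))) h
  simp [lastAxis] at this

/-- The sphere `𝕊ᵏ⁺¹`. [folklore] -/
abbrev Sph (k : ℕ) : Type := sphere (0 : EuclideanSpace ℝ (Fin (k + 2))) 1

/-- The closed upper cap `D₊ = {x_{k+1} ≥ 0}` of `𝕊ᵏ⁺¹`. [folklore] -/
abbrev capUp (k : ℕ) : Set (Sph k) := cap (lastAxis k)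

/-- The closed lower cap `D₋ = {x_{k+1} ≤ 0}` of `𝕊ᵏ⁺¹`. [folklore] -/
abbrev capDn (k : ℕ) : Set (Sph k) := cap (-lastAxis k)

/-- The equator `𝕊ᵏ = D₊ ∩ D₋`. [folklore] -/
abbrev equator (k : ℕ) : Set (Sph k) := capUp k ∩ capDn k

/-- The caps are contractible. [folklore] -/
instance contractibleSpace_capUp : ContractibleSpace ↥(capUp k) := contractibleSpace_cap lastAxis_ne_zero

/-- The caps are contractible. [folklore] -/
instance contractibleSpace_capDn : ContractibleSpace ↥(capDn k) :=
  contractibleSpace_cap (neg_ne_zero.2 lastAxis_ne_zero)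

/-- Every point of the sphere lies in one of the two caps. [folklore] -/
theorem mem_capUp_or_mem_capDn (x : Sph k) : x ∈ capUp k ∨ x ∈ capDn k := by
  have := (Set.ext_iff.1 (cap_union_cap_neg (lastAxis k))) x
  simpa using this

end Sphere

/-! ### 3. Clutching functions over `𝕊ᵏ⁺¹` with `K̃⁰(𝕊ᵏ⁺¹) = 0` are stably null-homotopic -/

section Main

variable {k N : ℕ}

/-- Evaluating a restricted function at a point of the piece. [folklore] -/
theorem map_resHom_map_evalRingHom {Y : Type u} [TopologicalSpace Y] {S : Set Y} {p q : Type*}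
    (M : Matrix p q C(Y, ℂ)) (y : S) :
    (M.map (resHom S)).map (evalRingHom y) = M.map (evalRingHom (y : Y)) := by
  rw [Matrix.map_map]; rfl

/-- Evaluating a function restricted to the overlap at a point of the overlap. [folklore] -/
theorem map_ovl₁_map_evalRingHom {Y : Type u} [TopologicalSpace Y] {X₁ X₂ : Set Y} {p q : Type*}
    (M : Matrix p q C(X₁, ℂ)) (z : ↥(X₁ ∩ X₂)) :
    (M.map (ovl₁ X₁ X₂)).map (evalRingHom z) = M.map (evalRingHom (Set.inclusion inter_subset_left z)) := by
  rw [Matrix.map_map]; rfl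

/-- Evaluating a function restricted to the overlap at a point of the overlap. [folklore] -/
theorem map_ovl₂_map_evalRingHom {Y : Type u} [TopologicalSpace Y] {X₁ X₂ : Set Y} {p q : Type*}
    (M : Matrix p q C(X₂, ℂ)) (z : ↥(X₁ ∩ X₂)) :
    (M.map (ovl₂ X₁ X₂)).map (evalRingHom z) = M.map (evalRingHom (Set.inclusion inter_subset_right z)) := by
  rw [Matrix.map_map]; rfl

/-- The continuous family `z ↦ 1_a ⊕ G(z)`. [folklore] -/
def blockOneFamily (a : ℕ) {Z : Type*} [TopologicalSpace Z] (G : C(Z, Matrix (Fin N) (Fin N) ℂ)) :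
    C(Z, Matrix (Fin a ⊕ Fin N) (Fin a ⊕ Fin N) ℂ) where
  toFun z := Matrix.fromBlocks 1 0 0 (G z)
  continuous_toFun := by
    refine continuous_matrix fun i j => ?_
    rcases i with i | i <;> rcases j with j | j
    · simp only [Matrix.fromBlocks_apply₁₁]; exact continuous_const
    · simp only [Matrix.fromBlocks_apply₁₂]; exact continuous_const
    · simp only [Matrix.fromBlocks_apply₂₁]; exact continuous_const
    · simp only [Matrix.fromBlocks_apply₂₂]; exact G.continuous.matrix_elem i j

/-- Value of `blockOneFamily`. [folklore] -/
@[simp] theorem blockOneFamily_apply (a : ℕ) {Z : Type*} [TopologicalSpace Z] (G : C(Z, Matrix (Fin N) (Fin N) ℂ)) (z : Z) :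
    blockOneFamily a G z = Matrix.fromBlocks 1 0 0 (G z) := rfl

/-- A square matrix with a right inverse has invertible determinant. [folklore] -/
theorem isUnit_det_of_mul_eq_one {n : Type*} [Fintype n] [DecidableEq n] {M M' : Matrix n n ℂ} (h : M * M' = 1) :
    IsUnit M.det :=
  Matrix.isUnit_det_of_right_inverse h

/-- **Clutching functions over a sphere with `K̃⁰ = 0` are stably null-homotopic through invertible
matrices.** Let `K̃⁰(𝕊ᵏ⁺¹, x₀) = 0` in the tree's idempotent model (`Reduced … x₀ = ⊥`). Then for
every continuous `G : 𝕊ᵏ → GL_N(ℂ)` on the equator `𝕊ᵏ = D₊ ∩ D₋` there are `a : ℕ` and a homotopy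
from `z ↦ 1_a ⊕ G(z)` to the constant `1` all of whose values are invertible. *Proof.* Glue
`Q = 1_N ∪_G 1_N` over `𝕊ᵏ⁺¹ = D₊ ∪ D₋` (`exists_gluingWitness`); `Q` has rank `N` at every point, so
`[Q] - [1_N]` is reduced, hence `0`, and `1_a ⊕ Q ∼ 1_{a+N}` for some `a`; the witness `1 ⊕ w` of
`1_a ⊕ Q` (transition `1 ⊕ G`) transports to a trivialising witness of the constant idempotent
`1_{a+N}`, whose tautological witness has transition `1`; by `GluingWitness.g_eq_conj`,
`1 ⊕ G = c₂|_𝕊ᵏ · d₁|_𝕊ᵏ` with `c₂`, `d₁` two-sided invertible over the contractible caps, so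
`1 ⊕ G` deforms through invertible matrices to a constant, which is joined to `1` in `GL`
(Husemöller, *Fibre Bundles*, Ch. 9 Thm. 7.3; Hatcher, VBKT Prop. 1.11: injectivity of
`[𝕊ᵏ, GL_N(ℂ)] → Vect(𝕊ᵏ⁺¹)`, stably). [cite: HusemollerFibreBundles1994, Ch. 9 Thm. 7.3]
[cite: HusemollerEtAl2008, Ch. 3 §7 (7.4)] -/
theorem exists_homotopy_blockOneFamily_of_reduced_eq_bot {x₀ : Sph k} (hK : Reduced (Sph k) x₀ = ⊥)
    (G : C(↥(equator k), Matrix (Fin N) (Fin N) ℂ)) (hG : ∀ z, IsUnit (G z).det) :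
    ∃ (a : ℕ) (H : (blockOneFamily a G).Homotopy (ContinuousMap.const _ 1)), ∀ p, IsUnit (H p).det := by
  classical
  -- the clutching data over the equator
  set u : Matrix (Fin N) (Fin N) C(↥(equator k), ℂ) := matrixUnswap G with hu
  set v : Matrix (Fin N) (Fin N) C(↥(equator k), ℂ) := matrixUnswap (invFamily G hG) with hv
  have hsw : ∀ (F : C(↥(equator k), Matrix (Fin N) (Fin N) ℂ)), matrixSwap (matrixUnswap F) = F :=
    fun F => by ext x i j; rfl
  have huv : u * v = 1 := by
    apply matrixSwap_injective
    ext z : 1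
    rw [matrixSwap_mul, hsw, hsw, matrixSwap_one, invFamily_apply, Matrix.mul_nonsing_inv _ (hG z)]
  have hvu : v * u = 1 := by
    apply matrixSwap_injective
    ext z : 1
    rw [matrixSwap_mul, hsw, hsw, matrixSwap_one, invFamily_apply, Matrix.nonsing_inv_mul _ (hG z)]
  -- glue `1_N ∪_u 1_N`
  have h1o₁ : (1 : Matrix (Fin N) (Fin N) C(↥(capUp k), ℂ)).map (ovl₁ (capUp k) (capDn k)) = 1 :=
    Matrix.map_one _ (map_zero _) (map_one _)
  have h1o₂ : (1 : Matrix (Fin N) (Fin N) C(↥(capDn k), ℂ)).map (ovl₂ (capUp k) (capDn k)) = 1 :=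
    Matrix.map_one _ (map_zero _) (map_one _)
  obtain ⟨Q, w, hw⟩ := exists_gluingWitness (X₁ := capUp k) (X₂ := capDn k) (isClosed_cap _) (isClosed_cap _) (cap_union_cap_neg _)
    (P₁ := (1 : Matrix (Fin N) (Fin N) C(↥(capUp k), ℂ))) (P₂ := (1 : Matrix (Fin N) (Fin N) C(↥(capDn k), ℂ)))
    IsIdempotentElem.one IsIdempotentElem.one u v huv hvu (by rw [h1o₁, h1o₂, Matrix.mul_one, huv])
  rw [h1o₁, h1o₂, Matrix.one_mul, Matrix.mul_one] at hw
  have hQ : IsIdempotentElem Q := w.isIdempotentElem (cap_union_cap_neg _)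
  -- `Q` has rank `N` everywhere
  have halg : ∀ x : Sph k, AlgEquivalent (Q.map (evalRingHom x)) (1 : Matrix (Fin N) (Fin N) ℂ) := by
    intro x
    rcases mem_capUp_or_mem_capDn x with hx | hx
    · have h := (w.algEquivalent₁).map (evalRingHom (⟨x, hx⟩ : ↥(capUp k)))
      rwa [map_resHom_map_evalRingHom, Matrix.map_one _ (map_zero _) (map_one _)] at h
    · have h := (w.algEquivalent₂).map (evalRingHom (⟨x, hx⟩ : ↥(capDn k)))
      rwa [map_resHom_map_evalRingHom, Matrix.map_one _ (map_zero _) (map_one _)] at h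
  -- `[Q] = [1_N]` in `K⁰`
  set q : Idem C(Sph k, ℂ) := Idem.ofMatrix Q hQ with hq
  have hrank : (q.map (evalRingHom x₀)).rank = ((Idem.unit N : Idem C(Sph k, ℂ)).map (evalRingHom x₀)).rank := by
    rw [Idem.map_unit]
    refine Idem.rank_congr (Idem.equiv_iff.2 ?_)
    exact ((Idem.algEquivalent_ofMatrix Q hQ).map (evalRingHom x₀)).trans (halg x₀)
  have hof : KZero.of q = KZero.of (Idem.unit N) := by
    have hmem : KZero.of q - KZero.of (Idem.unit N) ∈ Reduced (Sph k) x₀ := of_sub_of_mem_reduced_iff.2 hrank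
    rw [hK, AddSubgroup.mem_bot, sub_eq_zero] at hmem
    exact hmem
  obtain ⟨a, ha⟩ := KZero.of_eq_of_iff_exists_unit.1 hof
  rw [Idem.unit_add_unit] at ha
  -- `1_a ⊕ Q ∼ 1_{a+N}`
  have heq : AlgEquivalent (Matrix.fromBlocks (1 : Matrix (Fin a) (Fin a) C(Sph k, ℂ)) 0 0 Q)
      (1 : Matrix (Fin (a + N)) (Fin (a + N)) C(Sph k, ℂ)) := by
    have s1 : AlgEquivalent (Matrix.fromBlocks (1 : Matrix (Fin a) (Fin a) C(Sph k, ℂ)) 0 0 Q)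
        (Matrix.fromBlocks (Idem.unit a : Idem C(Sph k, ℂ)).mat 0 0 q.mat) :=
      AlgEquivalent.fromBlocks (AlgEquivalent.refl IsIdempotentElem.one) (Idem.algEquivalent_ofMatrix Q hQ).symm
    exact s1.trans ((Idem.add_equiv_fromBlocks _ _).symm.trans (Idem.equiv_iff.1 ha))
  -- the witness `1 ⊕ w` of `1_a ⊕ Q`, transition `1 ⊕ u`
  let w₁ : GluingWitness (1 : Matrix (Fin a) (Fin a) C(Sph k, ℂ)) (1 : Matrix (Fin a) (Fin a) C(↥(capUp k), ℂ))
      (1 : Matrix (Fin a) (Fin a) C(↥(capDn k), ℂ)) :=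
    (GluingWitness.tautological (X₁ := capUp k) (X₂ := capDn k) IsIdempotentElem.one).castModels
      (Matrix.map_one _ (map_zero _) (map_one _)) (Matrix.map_one _ (map_zero _) (map_one _))
  have hw₁ : w₁.g = 1 := by
    rw [GluingWitness.g_castModels, GluingWitness.g_tautological, Matrix.map_one _ (map_zero _) (map_one _),
      Matrix.map_one _ (map_zero _) (map_one _)]
  let W : GluingWitness (Matrix.fromBlocks (1 : Matrix (Fin a) (Fin a) C(Sph k, ℂ)) 0 0 Q)
      (1 : Matrix (Fin a ⊕ Fin N) (Fin a ⊕ Fin N) C(↥(capUp k), ℂ)) (1 : Matrix (Fin a ⊕ Fin N) (Fin a ⊕ Fin N) C(↥(capDn k), ℂ)) :=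
    (w₁.sum w).castModels (Matrix.fromBlocks_one) (Matrix.fromBlocks_one)
  have hW : W.g = Matrix.fromBlocks 1 0 0 u := by
    rw [GluingWitness.g_castModels, GluingWitness.g_sum, hw₁, hw]
  -- transport to the constant idempotent `1_{a+N}`
  obtain ⟨x, y, hxy, hyx, -, -, -, hyp⟩ := heq.exists_normalized
  let W' : GluingWitness (1 : Matrix (Fin (a + N)) (Fin (a + N)) C(Sph k, ℂ))
      (1 : Matrix (Fin a ⊕ Fin N) (Fin a ⊕ Fin N) C(↥(capUp k), ℂ)) (1 : Matrix (Fin a ⊕ Fin N) (Fin a ⊕ Fin N) C(↥(capDn k), ℂ)) :=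
    W.ofAlgEquivalent y x hyx hxy (by rw [hyx, Matrix.one_mul])
  have hW' : W'.g = Matrix.fromBlocks 1 0 0 u := by rw [GluingWitness.g_ofAlgEquivalent, hW]
  -- the tautological (trivial) witness of `1_{a+N}`
  let W₀ : GluingWitness (1 : Matrix (Fin (a + N)) (Fin (a + N)) C(Sph k, ℂ))
      (1 : Matrix (Fin (a + N)) (Fin (a + N)) C(↥(capUp k), ℂ)) (1 : Matrix (Fin (a + N)) (Fin (a + N)) C(↥(capDn k), ℂ)) :=
    (GluingWitness.tautological (X₁ := capUp k) (X₂ := capDn k) IsIdempotentElem.one).castModels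
      (Matrix.map_one _ (map_zero _) (map_one _)) (Matrix.map_one _ (map_zero _) (map_one _))
  have hW₀ : W₀.g = 1 := by
    rw [GluingWitness.g_castModels, GluingWitness.g_tautological, Matrix.map_one _ (map_zero _) (map_one _),
      Matrix.map_one _ (map_zero _) (map_one _)]
  -- `1 ⊕ u = c₂|_A d₁|_A`
  set C := GluingWitness.frame₂ W₀ W' with hC
  set C' := GluingWitness.frame₂ W' W₀ with hC'
  set D := GluingWitness.frame₁ W₀ W' with hD
  set D' := GluingWitness.frame₁ W' W₀ with hD'
  have hCC' : C * C' = 1 := GluingWitness.frame₂_mul_frame₂ W₀ W'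
  have hC'C : C' * C = 1 := GluingWitness.frame₂_mul_frame₂ W' W₀
  have hDD' : D * D' = 1 := GluingWitness.frame₁_mul_frame₁ W₀ W'
  have hD'D : D' * D = 1 := GluingWitness.frame₁_mul_frame₁ W' W₀
  have hconj : Matrix.fromBlocks 1 0 0 u = C.map (ovl₂ (capUp k) (capDn k)) * D.map (ovl₁ (capUp k) (capDn k)) := by
    rw [← hW', GluingWitness.g_eq_conj W₀ W', hW₀, Matrix.mul_one]
  -- pointwise families
  let Cf : C(↥(capDn k), Matrix (Fin a ⊕ Fin N) (Fin (a + N)) ℂ) := matrixSwap C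
  let C'f : C(↥(capDn k), Matrix (Fin (a + N)) (Fin a ⊕ Fin N) ℂ) := matrixSwap C'
  let Df : C(↥(capUp k), Matrix (Fin (a + N)) (Fin a ⊕ Fin N) ℂ) := matrixSwap D
  let D'f : C(↥(capUp k), Matrix (Fin a ⊕ Fin N) (Fin (a + N)) ℂ) := matrixSwap D'
  have hCf : ∀ y, Cf y * C'f y = 1 := fun y => by
    change matrixSwap C y * matrixSwap C' y = 1
    rw [← matrixSwap_mul, hCC', matrixSwap_one]
  have hC'f : ∀ y, C'f y * Cf y = 1 := fun y => by
    change matrixSwap C' y * matrixSwap C y = 1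
    rw [← matrixSwap_mul, hC'C, matrixSwap_one]
  have hDf : ∀ y, Df y * D'f y = 1 := fun y => by
    change matrixSwap D y * matrixSwap D' y = 1
    rw [← matrixSwap_mul, hDD', matrixSwap_one]
  have hD'f : ∀ y, D'f y * Df y = 1 := fun y => by
    change matrixSwap D' y * matrixSwap D y = 1
    rw [← matrixSwap_mul, hD'D, matrixSwap_one]
  let i₁ : ↥(equator k) → ↥(capUp k) := Set.inclusion inter_subset_left
  let i₂ : ↥(equator k) → ↥(capDn k) := Set.inclusion inter_subset_right
  have hi₁ : Continuous i₁ := continuous_inclusion _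
  have hi₂ : Continuous i₂ := continuous_inclusion _
  have hpt : ∀ z : ↥(equator k), Matrix.fromBlocks 1 0 0 (G z) = Cf (i₂ z) * Df (i₁ z) := fun z => by
    have h : matrixSwap (Matrix.fromBlocks (1 : Matrix (Fin a) (Fin a) C(↥(equator k), ℂ)) 0 0 u) z =
        matrixSwap (C.map (ovl₂ (capUp k) (capDn k)) * D.map (ovl₁ (capUp k) (capDn k))) z := by rw [hconj]
    rw [matrixSwap_mul] at h
    have e0 : matrixSwap (Matrix.fromBlocks (1 : Matrix (Fin a) (Fin a) C(↥(equator k), ℂ)) 0 0 u) z =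
        Matrix.fromBlocks 1 0 0 (G z) := by
      rw [matrixSwap_apply, Matrix.fromBlocks_map]
      congr 1
      exact Matrix.map_one _ rfl rfl
    have e1 : matrixSwap (C.map (ovl₂ (capUp k) (capDn k))) z = Cf (i₂ z) := by
      ext i j; rfl
    have e2 : matrixSwap (D.map (ovl₁ (capUp k) (capDn k))) z = Df (i₁ z) := by
      ext i j; rfl
    rw [← e0, h, e1, e2]
  -- invertibility of the products `Cf y · Df y'`
  have hprod : ∀ (y : ↥(capDn k)) (y' : ↥(capUp k)), IsUnit (Cf y * Df y').det := fun y y' =>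
    isUnit_det_of_mul_eq_one (M' := D'f y' * C'f y) (by
      rw [Matrix.mul_assoc, ← Matrix.mul_assoc (Df y'), hDf, Matrix.one_mul, hCf])
  -- contract the caps
  obtain ⟨p₁, ⟨K₁⟩⟩ := id_nullhomotopic ↥(capUp k)
  obtain ⟨p₂, ⟨K₂⟩⟩ := id_nullhomotopic ↥(capDn k)
  set M₀ : Matrix (Fin a ⊕ Fin N) (Fin a ⊕ Fin N) ℂ := Cf p₂ * Df p₁ with hM₀
  have hM₀u : IsUnit M₀.det := hprod p₂ p₁
  obtain ⟨γ, hγ⟩ := isPathConnected_isUnit_det.joinedIn M₀ hM₀u 1 (by simp)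
  let Φ : (blockOneFamily a G).Homotopy (ContinuousMap.const ↥(equator k) M₀) :=
    { toFun := fun p => Cf (K₂ (p.1, i₂ p.2)) * Df (K₁ (p.1, i₁ p.2))
      continuous_toFun := (Cf.continuous.comp (K₂.continuous.comp (continuous_fst.prodMk (hi₂.comp continuous_snd)))).matrix_mul
        (Df.continuous.comp (K₁.continuous.comp (continuous_fst.prodMk (hi₁.comp continuous_snd))))
      map_zero_left := fun z => by
        change Cf (K₂ (0, i₂ z)) * Df (K₁ (0, i₁ z)) = Matrix.fromBlocks 1 0 0 (G z)
        rw [K₂.apply_zero, K₁.apply_zero, hpt]; rfl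
      map_one_left := fun z => by
        change Cf (K₂ (1, i₂ z)) * Df (K₁ (1, i₁ z)) = M₀
        rw [K₂.apply_one, K₁.apply_one]; rfl }
  let Ψ : (ContinuousMap.const ↥(equator k) M₀).Homotopy (ContinuousMap.const ↥(equator k) (1 : Matrix (Fin a ⊕ Fin N) (Fin a ⊕ Fin N) ℂ)) :=
    { toFun := fun p => γ p.1
      continuous_toFun := γ.continuous.comp continuous_fst
      map_zero_left := fun z => by change γ 0 = M₀; exact γ.source
      map_one_left := fun z => by change γ 1 = 1; exact γ.target }
  refine ⟨a, Φ.trans Ψ, fun p => ?_⟩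
  rw [ContinuousMap.Homotopy.trans_apply]
  split_ifs with h
  · exact hprod _ _
  · exact hγ _

end Main

end Literature.AlgebraicTopology.KTheory
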